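import Summits.KontsevichZagierPeriods.KontsevichZagierPeriods.Theorems.HurwitzMicroSectorsNormalFormPrinciplePiBoxTower
import Summits.KontsevichZagierPeriods.KontsevichZagierPeriods.Theorems.HurwitzMicroSectorsNormalFormPrincipleStubSignPresentation

/-!
# `NormalFormPrinciple` (stmt-KontsevichZagierPeriods-3869), line `SketchIdeator1` ("π buys geometry") —
# stub `stub_volumePiBox`: bounded volumes are box-rational up to a power of `[π]`

The lead's registered stub of the crux skeleton (`Cruxes/NormalFormPrinciple/Lines/SketchIdeator1.lean`):
for a representation `[A, 1]` with bounded `ℚ`-semialgebraic `A ⊆ ℝᵈ` there are `k` and a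
BOX-RATIONAL representation `N` (domain the open unit box `(0,1)ᵐ`, integrand `p/q` over `ℚ` with
`q ≠ 0` on it — KZ's §1.1 shape with the domain frozen) such that `[π]^k·[A] − [N] ∈ KZ.relations`.
Proof: `exists_unitBox_model` (into `(0,1)ᵈ`, constant integrand), `stub_signPresentation` (disjoint
strict sign cells of a finite family `F` of non-zero polynomials, up to a null set; the degenerate
case `0 ∈ F` has null domain), the tower on each cell with the signed polynomials `±p`
(`tower`: all cells land on the common domain `{p ≠ 0 ∀ p ∈ F} × [0,1]^k`, `k = |F|`), restriction
to the open box (null faces), iterated integrand additivity over the cells, and filling the null set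
`{∏ p = 0}`: the result is one rational function `Σ_ε Tᵈ ∏ⱼ K(±pⱼ(x), uⱼ)` on `(0,1)^{d+k}`
(closure of "`p/q` on `s`, `q ≠ 0` on `s`" under sums and products). Pure proof file.
Source for the calculus: M. Kontsevich, D. Zagier, *Periods* (2001), §1.2.
-/

noncomputable section

open MeasureTheory Set
open Literature.NumberTheory.Transcendental Literature.NumberTheory.Transcendental.KZ
open Literature.ModelTheory.ExponentialFields (IsSemialgebraic)

namespace Summit.KontsevichZagierPeriods.HurwitzMicroSectors.NormalFormPrinciple.PiBox

variable {n m : ℕ}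

/-! ## Rational functions on a set: closure properties (the shape of `IsRational`) -/

/-- Sums of rational functions (non-vanishing denominators on `s`) are rational on `s`. [folklore] -/
theorem ratOn_add {N : ℕ} {s : Set (Fin N → ℝ)} {f g : (Fin N → ℝ) → ℝ}
    (hf : ∃ p q : MvPolynomial (Fin N) ℚ, (∀ x ∈ s, MvPolynomial.aeval x q ≠ 0) ∧
      EqOn f (fun x => MvPolynomial.aeval x p / MvPolynomial.aeval x q) s)
    (hg : ∃ p q : MvPolynomial (Fin N) ℚ, (∀ x ∈ s, MvPolynomial.aeval x q ≠ 0) ∧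
      EqOn g (fun x => MvPolynomial.aeval x p / MvPolynomial.aeval x q) s) :
    ∃ p q : MvPolynomial (Fin N) ℚ, (∀ x ∈ s, MvPolynomial.aeval x q ≠ 0) ∧
      EqOn (fun x => f x + g x) (fun x => MvPolynomial.aeval x p / MvPolynomial.aeval x q) s := by
  obtain ⟨p, q, hq, hfe⟩ := hf
  obtain ⟨p', q', hq', hge⟩ := hg
  refine ⟨p * q' + p' * q, q * q', fun x hx => by simpa using ⟨hq x hx, hq' x hx⟩, fun x hx => ?_⟩
  simp only [hfe hx, hge hx, map_add, map_mul]
  field_simp [hq x hx, hq' x hx]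

/-- Products of rational functions are rational. [folklore] -/
theorem ratOn_mul {N : ℕ} {s : Set (Fin N → ℝ)} {f g : (Fin N → ℝ) → ℝ}
    (hf : ∃ p q : MvPolynomial (Fin N) ℚ, (∀ x ∈ s, MvPolynomial.aeval x q ≠ 0) ∧
      EqOn f (fun x => MvPolynomial.aeval x p / MvPolynomial.aeval x q) s)
    (hg : ∃ p q : MvPolynomial (Fin N) ℚ, (∀ x ∈ s, MvPolynomial.aeval x q ≠ 0) ∧
      EqOn g (fun x => MvPolynomial.aeval x p / MvPolynomial.aeval x q) s) :
    ∃ p q : MvPolynomial (Fin N) ℚ, (∀ x ∈ s, MvPolynomial.aeval x q ≠ 0) ∧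
      EqOn (fun x => f x * g x) (fun x => MvPolynomial.aeval x p / MvPolynomial.aeval x q) s := by
  obtain ⟨p, q, hq, hfe⟩ := hf
  obtain ⟨p', q', hq', hge⟩ := hg
  refine ⟨p * p', q * q', fun x hx => by simpa using ⟨hq x hx, hq' x hx⟩, fun x hx => ?_⟩
  simp only [hfe hx, hge hx, map_mul]
  field_simp

/-- Rational constants are rational functions. [folklore] -/
theorem ratOn_const {N : ℕ} {s : Set (Fin N → ℝ)} (c : ℚ) :
    ∃ p q : MvPolynomial (Fin N) ℚ, (∀ x ∈ s, MvPolynomial.aeval x q ≠ 0) ∧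
      EqOn (fun _ => (c : ℝ)) (fun x => MvPolynomial.aeval x p / MvPolynomial.aeval x q) s :=
  ⟨MvPolynomial.C c, 1, fun x _ => by simp, fun x _ => by simp⟩

/-- Finite products of rational functions are rational. [folklore] -/
theorem ratOn_prod {N : ℕ} {s : Set (Fin N → ℝ)} {ι : Type*} (t : Finset ι) {f : ι → (Fin N → ℝ) → ℝ}
    (hf : ∀ i ∈ t, ∃ p q : MvPolynomial (Fin N) ℚ, (∀ x ∈ s, MvPolynomial.aeval x q ≠ 0) ∧
      EqOn (f i) (fun x => MvPolynomial.aeval x p / MvPolynomial.aeval x q) s) :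
    ∃ p q : MvPolynomial (Fin N) ℚ, (∀ x ∈ s, MvPolynomial.aeval x q ≠ 0) ∧
      EqOn (fun x => ∏ i ∈ t, f i x) (fun x => MvPolynomial.aeval x p / MvPolynomial.aeval x q) s := by
  classical
  induction t using Finset.induction_on with
  | empty => simpa using ratOn_const (s := s) 1
  | insert a t ha ih =>
    have h := ratOn_mul (hf a (Finset.mem_insert_self a t))
      (ih fun i hi => hf i (Finset.mem_insert_of_mem hi))
    obtain ⟨p, q, hq, he⟩ := h
    exact ⟨p, q, hq, fun x hx => by
      show ∏ i ∈ insert a t, f i x = _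
      rw [Finset.prod_insert ha]; exact he hx⟩

/-- Finite sums of rational functions are rational. [folklore] -/
theorem ratOn_sum {N : ℕ} {s : Set (Fin N → ℝ)} {ι : Type*} (t : Finset ι) {f : ι → (Fin N → ℝ) → ℝ}
    (hf : ∀ i ∈ t, ∃ p q : MvPolynomial (Fin N) ℚ, (∀ x ∈ s, MvPolynomial.aeval x q ≠ 0) ∧
      EqOn (f i) (fun x => MvPolynomial.aeval x p / MvPolynomial.aeval x q) s) :
    ∃ p q : MvPolynomial (Fin N) ℚ, (∀ x ∈ s, MvPolynomial.aeval x q ≠ 0) ∧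
      EqOn (fun x => ∑ i ∈ t, f i x) (fun x => MvPolynomial.aeval x p / MvPolynomial.aeval x q) s := by
  classical
  induction t using Finset.induction_on with
  | empty => simpa using ratOn_const (s := s) 0
  | insert a t ha ih =>
    have h := ratOn_add (hf a (Finset.mem_insert_self a t))
      (ih fun i hi => hf i (Finset.mem_insert_of_mem hi))
    obtain ⟨p, q, hq, he⟩ := h
    exact ⟨p, q, hq, fun x hx => by
      show ∑ i ∈ insert a t, f i x = _
      rw [Finset.sum_insert ha]; exact he hx⟩

/-- The sign kernel `K(P(x), u_j)` is a rational function on the open unit box (its denominators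
`P²(1−u)²+u²`, `(1−u)²+u²` are positive for `u ∈ (0,1)`). [folklore] -/
theorem ratOn_kernel {d k : ℕ} (P : MvPolynomial (Fin d) ℚ) (j : Fin k) :
    ∃ p q : MvPolynomial (Fin (d + k)) ℚ,
      (∀ x ∈ {z : Fin (d + k) → ℝ | ∀ i, z i ∈ Set.Ioo (0:ℝ) 1}, MvPolynomial.aeval x q ≠ 0) ∧
      EqOn (fun z => ((MvPolynomial.aeval (fun i => z (Fin.castAdd k i)) P) / ((MvPolynomial.aeval (fun i => z (Fin.castAdd k i)) P) ^ 2 * (1 - (z (Fin.natAdd d j))) ^ 2 + (z (Fin.natAdd d j)) ^ 2) + 1 / ((1 - (z (Fin.natAdd d j))) ^ 2 + (z (Fin.natAdd d j)) ^ 2)))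
        (fun x => MvPolynomial.aeval x p / MvPolynomial.aeval x q)
        {z : Fin (d + k) → ℝ | ∀ i, z i ∈ Set.Ioo (0:ℝ) 1} := by
  set Pr : MvPolynomial (Fin (d + k)) ℚ := MvPolynomial.rename (Fin.castAdd k) P with hPr
  set U : MvPolynomial (Fin (d + k)) ℚ := MvPolynomial.X (Fin.natAdd d j) with hU
  have haP : ∀ z : Fin (d + k) → ℝ,
      MvPolynomial.aeval z Pr = MvPolynomial.aeval (fun i => z (Fin.castAdd k i)) P := fun z => by
    rw [hPr, MvPolynomial.aeval_rename]; rfl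
  have hpos1 : ∀ z ∈ {z : Fin (d + k) → ℝ | ∀ i, z i ∈ Set.Ioo (0:ℝ) 1},
      0 < (MvPolynomial.aeval (fun i => z (Fin.castAdd k i)) P) ^ 2 * (1 - z (Fin.natAdd d j)) ^ 2 +
        z (Fin.natAdd d j) ^ 2 := fun z hz => by
    have := (hz (Fin.natAdd d j)).1
    positivity
  have hpos2 : ∀ z ∈ {z : Fin (d + k) → ℝ | ∀ i, z i ∈ Set.Ioo (0:ℝ) 1},
      0 < (1 - z (Fin.natAdd d j)) ^ 2 + z (Fin.natAdd d j) ^ 2 := fun z hz => by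
    have := (hz (Fin.natAdd d j)).1
    positivity
  refine ratOn_add ⟨Pr, Pr ^ 2 * (1 - U) ^ 2 + U ^ 2, fun z hz => ?_, fun z hz => ?_⟩
    ⟨1, (1 - U) ^ 2 + U ^ 2, fun z hz => ?_, fun z hz => ?_⟩
  · simp only [map_add, map_mul, map_pow, map_sub, map_one, haP, hU, MvPolynomial.aeval_X]
    exact (hpos1 z hz).ne'
  · simp only [map_add, map_mul, map_pow, map_sub, map_one, haP, hU, MvPolynomial.aeval_X]
  · simp only [map_add, map_pow, map_sub, map_one, hU, MvPolynomial.aeval_X]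
    exact (hpos2 z hz).ne'
  · simp only [map_add, map_pow, map_sub, map_one, hU, MvPolynomial.aeval_X]

/-! ## Strict sign cells as positivity cells of signed polynomials -/

/-- A strict sign condition `sign p(x) = ε p` (`ε p ≠ 0`) is the positivity of the signed polynomial
`±p`. [folklore] -/
theorem sign_eq_iff_pos {d : ℕ} (p : MvPolynomial (Fin d) ℚ) (s : SignType) (hs : s ≠ 0)
    (x : Fin d → ℝ) :
    SignType.sign (MvPolynomial.aeval x p) = s ↔
      0 < MvPolynomial.aeval x (if s = 1 then p else -p) := by
  rcases s with _ | _ | _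
  · exact absurd rfl hs
  · simp only [show (SignType.neg = 1) = False by decide, if_false, map_neg, neg_pos]
    exact sign_eq_neg_one_iff
  · simp only [show SignType.pos = 1 from rfl, if_true]
    exact sign_eq_one_iff

/-- The signed polynomial `±p` vanishes exactly where `p` does. [folklore] -/
theorem signed_ne_zero_iff {d : ℕ} (p : MvPolynomial (Fin d) ℚ) (s : SignType) (x : Fin d → ℝ) :
    MvPolynomial.aeval x (if s = 1 then p else -p) ≠ 0 ↔ MvPolynomial.aeval x p ≠ 0 := by
  split_ifs <;> simp

/-! ## The stub -/

/-- **`stub_volumePiBox` (the lead's stub, PROVED modulo `stub_signKernelRep/Split`, `stub_piCalibration`,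
`stub_signPresentation`)**: for a representation `[A, 1]` with bounded `ℚ`-semialgebraic
`A ⊆ ℝᵈ` there are `k` and a box-rational `N` with `[π]^k · [A] ≡ [N]`. Translation and scaling put
`A` inside the open unit box with a constant integrand `c = Tᵈ` (`exists_unitBox_model`); the sign
presentation (`stub_signPresentation`) writes `A` as the disjoint union of the strict sign cells of a
finite family `F` of non-zero polynomials, up to a null set (rule 1a)); on each cell the
`k = |F|`-fold sign-kernel tower (`tower`) gives `[π]^k · [cell, c] ≡ [Nε]` on the common domain
`{x ∈ (0,1)ᵈ, p(x) ≠ 0 ∀ p ∈ F} × [0,1]^k` with integrand `c ∏ⱼ K(±pⱼ(x), uⱼ)`; restricting to the open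
box (null faces), summing the integrands (rule 1b)) and filling the null set `{∏ p = 0}` gives one
rational function on the open unit box `(0,1)^{d+k}`. [cite: KontsevichZagier2001, §1.2] -/
theorem stub_volumePiBox :
    ∀ (d : ℕ) (A : IntegralRep d), Bornology.IsBounded A.domain → (∀ z ∈ A.domain, A.integrand z = 1) →
    ∃ (k m : ℕ) (N : IntegralRep m), N.domain = {x | ∀ i, x i ∈ Set.Ioo (0:ℝ) 1} ∧ N.IsRational ∧
      (fun c => of piRep * c)^[k] (of A) - of N ∈ relations := by
  classical
  intro d A hb h1
  -- into the unit box, constant integrand `c = T^d`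
  obtain ⟨T, B, hT, hBsub, hBi, hAB⟩ := exists_unitBox_model A hb h1
  -- sign presentation of `B.domain`
  obtain ⟨F, S, hSstrict, hScell, hSnull⟩ := stub_signPresentation d B.domain B.isSemialgebraic_domain
  -- degenerate case: the zero polynomial is in the family, so every strict cell is empty
  by_cases hF0 : (0 : MvPolynomial (Fin d) ℚ) ∈ F
  · have hempty : ∀ ε ∈ S, {x : Fin d → ℝ | ∀ p : F,
        SignType.sign (MvPolynomial.aeval x (p : MvPolynomial (Fin d) ℚ)) = ε p} = ∅ := by
      intro ε hε
      ext x
      simp only [mem_setOf_eq, mem_empty_iff_false, iff_false, not_forall]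
      exact ⟨⟨0, hF0⟩, by simpa using (hSstrict ε hε ⟨0, hF0⟩).symm⟩
    have hBnull : volume B.domain = 0 := by
      have : (⋃ ε ∈ S, {x : Fin d → ℝ | ∀ p : F,
          SignType.sign (MvPolynomial.aeval x (p : MvPolynomial (Fin d) ℚ)) = ε p}) = ∅ := by
        simp only [iUnion_eq_empty]
        exact fun ε hε => hempty ε hε
      rw [this, Set.sdiff_empty] at hSnull
      exact hSnull
    obtain ⟨k, m, N, hNd, hNr, hN⟩ := exists_boxRat_of_null B hBnull
    refine ⟨k, m, N, hNd, hNr, ?_⟩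
    have := relations.add_mem (piPow_congr k hAB) hN
    rwa [sub_add_sub_cancel] at this
  -- the non-degenerate case: all members of `F` are non-zero
  have hFne : ∀ p : F, (p : MvPolynomial (Fin d) ℚ) ≠ 0 := fun p h => hF0 (h ▸ p.2)
  set k : ℕ := F.card with hk
  let e : Fin k ≃ F := F.equivFin.symm
  -- signed polynomials of a sign vector, enumerated by `Fin k`
  let P : (F → SignType) → Fin k → MvPolynomial (Fin d) ℚ := fun ε j =>
    if ε (e j) = 1 then (e j : MvPolynomial (Fin d) ℚ) else -(e j : MvPolynomial (Fin d) ℚ)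
  have hcell : ∀ ε, (∀ p : F, ε p ≠ 0) → ∀ x : Fin d → ℝ,
      (∀ p : F, SignType.sign (MvPolynomial.aeval x (p : MvPolynomial (Fin d) ℚ)) = ε p) ↔
        ∀ j, 0 < MvPolynomial.aeval x (P ε j) := by
    intro ε hε x
    constructor
    · intro h j
      exact (sign_eq_iff_pos _ _ (hε _) x).1 (h (e j))
    · intro h p
      have := h (e.symm p)
      simp only [P, Equiv.apply_symm_apply] at this
      exact (sign_eq_iff_pos _ _ (hε p) x).2 this
  have hcell_ne : ∀ ε (x : Fin d → ℝ), (∀ j, MvPolynomial.aeval x (P ε j) ≠ 0) ↔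
      ∀ p : F, MvPolynomial.aeval x (p : MvPolynomial (Fin d) ℚ) ≠ 0 := by
    intro ε x
    constructor
    · intro h p
      have := h (e.symm p)
      simp only [P, Equiv.apply_symm_apply] at this
      exact (signed_ne_zero_iff _ _ x).1 this
    · intro h j
      exact (signed_ne_zero_iff _ _ x).2 (h (e j))
  -- the base representation `[(0,1)^d, c]` and the cells
  set Ud : Set (Fin d → ℝ) := {x | ∀ i, x i ∈ Set.Ioo (0:ℝ) 1} with hUd
  have hUdvol : volume Ud < ⊤ :=
    (measure_mono (fun x hx => ⟨fun i => (hx i).1.le, fun i => (hx i).2.le⟩ :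
      Ud ⊆ Set.Icc (0 : Fin d → ℝ) 1)).trans_lt (Metric.isBounded_Icc (0 : Fin d → ℝ) 1).measure_lt_top
  let r₀ : IntegralRep d :=
    { domain := Ud
      integrand := fun _ => (T : ℝ) ^ d
      isSemialgebraic_domain := isSemialgebraic_box d
      isSemialgebraicFunOn_integrand :=
        (isSemialgebraicFunOn_ratCast (isSemialgebraic_box d) ((T : ℚ) ^ d)).congr
          fun x _ => by push_cast; rfl
      integrableOn := integrableOn_const (hs := hUdvol.ne) }
  have hcellsa : ∀ ε, IsSemialgebraic ℚ {x | x ∈ r₀.domain ∧ ∀ j, 0 < MvPolynomial.aeval x (P ε j)} := by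
    intro ε
    have : {x | x ∈ r₀.domain ∧ ∀ j, 0 < MvPolynomial.aeval x (P ε j)} =
        Ud ∩ ⋂ j ∈ (Finset.univ : Finset (Fin k)), {x | 0 < MvPolynomial.aeval x (P ε j)} := by
      ext x; simp [r₀]
    rw [this]
    exact (isSemialgebraic_box d).inter (IsSemialgebraic.biInter _ _ fun j _ =>
      Literature.ModelTheory.ExponentialFields.isSemialgebraic_setOf_eval_pos _)
  let rc : (F → SignType) → IntegralRep d := fun ε => r₀.restrict _ (hcellsa ε) fun x hx => hx.1
  -- the tower on each cell
  have htow := fun ε => tower k d r₀ (P ε) (rc ε) rfl rfl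
  choose Nf hNfd hNfi hNf using htow
  -- (1) `[B] ≡ Σ_ε [rc ε]`
  have hBsum : of B - ∑ ε ∈ S, of (rc ε) ∈ relations := by
    refine of_sub_sum_of_mem_relations S B rc (fun ε hε => ?_) (fun ε hε => ?_) ?_ ?_
    · have : (rc ε).domain \ B.domain = ∅ := by
        refine Set.sdiff_eq_empty.2 fun x hx => hScell ε hε ?_
        exact (hcell ε (hSstrict ε hε) x).2 hx.2
      rw [this, measure_empty]
    · intro x _
      show (T : ℝ) ^ d = B.integrand x
      rw [hBi]
    · have hsub : B.domain \ ⋃ ε ∈ S, (rc ε).domain ⊆ B.domain \ ⋃ ε ∈ S, {x : Fin d → ℝ | ∀ p : F,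
          SignType.sign (MvPolynomial.aeval x (p : MvPolynomial (Fin d) ℚ)) = ε p} := by
        intro x hx
        refine ⟨hx.1, fun hx' => hx.2 ?_⟩
        simp only [mem_iUnion] at hx' ⊢
        obtain ⟨ε, hε, hxε⟩ := hx'
        exact ⟨ε, hε, hBsub hx.1, (hcell ε (hSstrict ε hε) x).1 hxε⟩
      exact measure_mono_null hsub hSnull
    · intro ε hε ε' hε' hne
      have : (rc ε).domain ∩ (rc ε').domain = ∅ := by
        refine eq_empty_of_forall_notMem fun x hx => hne ?_
        funext p
        have h₁ := ((hcell ε (hSstrict ε hε) x).2 hx.1.2) p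
        have h₂ := ((hcell ε' (hSstrict ε' hε') x).2 hx.2.2) p
        rw [← h₁, ← h₂]
      rw [this, measure_empty]
  -- (2) the common open domain `W` and the restrictions of the tower outputs
  set W : Set (Fin (d + k) → ℝ) := {z | (∀ i, z i ∈ Set.Ioo (0:ℝ) 1) ∧
      ∀ p : F, MvPolynomial.aeval (fun i => z (Fin.castAdd k i)) (p : MvPolynomial (Fin d) ℚ) ≠ 0}
    with hW
  have hWsa : IsSemialgebraic ℚ W := by
    have : W = {z | ∀ i, z i ∈ Set.Ioo (0:ℝ) 1} ∩ ⋂ p ∈ F.attach,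
        {z | MvPolynomial.aeval z (MvPolynomial.rename (Fin.castAdd k)
          (p : MvPolynomial (Fin d) ℚ)) ≠ 0} := by
      ext z
      simp only [hW, mem_setOf_eq, mem_inter_iff, mem_iInter, Finset.mem_attach, forall_const,
        MvPolynomial.aeval_rename]
      rfl
    rw [this]
    exact (isSemialgebraic_box (d + k)).inter (IsSemialgebraic.biInter _ _ fun p _ =>
      Literature.ModelTheory.ExponentialFields.isSemialgebraic_setOf_eval_ne_zero _)
  have hWsub : ∀ ε, W ⊆ (Nf ε).domain := by
    intro ε z hz
    rw [hNfd]
    refine ⟨fun i => hz.1 _, (hcell_ne ε _).2 hz.2, fun j => Ioo_subset_Icc_self (hz.1 _)⟩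
  have hWnull : ∀ ε, volume ((Nf ε).domain \ W) = 0 := by
    intro ε
    have hsub : (Nf ε).domain \ W ⊆ ⋃ j : Fin k,
        ({z : Fin (d + k) → ℝ | z (Fin.natAdd d j) = 0} ∪ {z | z (Fin.natAdd d j) = 1}) := by
      intro z hz
      rw [hNfd] at hz
      obtain ⟨⟨hx, hP, hu⟩, hzW⟩ := hz
      have hp : ∀ p : F, MvPolynomial.aeval (fun i => z (Fin.castAdd k i))
          (p : MvPolynomial (Fin d) ℚ) ≠ 0 := (hcell_ne ε _).1 hP
      have : ¬ ∀ i, z i ∈ Set.Ioo (0:ℝ) 1 := fun h => hzW ⟨h, hp⟩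
      simp only [not_forall] at this
      obtain ⟨i, hi⟩ := this
      simp only [mem_iUnion, mem_union, mem_setOf_eq]
      induction i using Fin.addCases with
      | left i => exact absurd (hx i) hi
      | right j =>
        refine ⟨j, ?_⟩
        rcases (hu j).1.eq_or_lt with h | h
        · exact Or.inl h.symm
        · rcases (hu j).2.eq_or_lt with h' | h'
          · exact Or.inr h'
          · exact absurd ⟨h, h'⟩ hi
    exact measure_mono_null hsub ((measure_iUnion_null_iff).2 fun j =>
      measure_union_null (by rw [volume_pi]; exact Measure.pi_hyperplane _ _ _) (by rw [volume_pi]; exact Measure.pi_hyperplane _ _ _))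
  let Nr : (F → SignType) → IntegralRep (d + k) := fun ε => (Nf ε).restrict W hWsa (hWsub ε)
  have hNr : ∀ ε, of (Nf ε) - of (Nr ε) ∈ relations := fun ε =>
    (Nf ε).of_sub_of_restrict_mem_relations hWsa (hWsub ε) (hWnull ε)
  -- (3) summing the integrands on `W`
  let M₀ : IntegralRep (d + k) :=
    { domain := W
      integrand := fun z => ∑ ε ∈ S, (Nf ε).integrand z
      isSemialgebraic_domain := hWsa
      isSemialgebraicFunOn_integrand := isSemialgebraicFunOn_finset_sum _ hWsa fun ε _ =>
        (Nr ε).isSemialgebraicFunOn_integrand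
      integrableOn := by
        have : IntegrableOn (fun z => ∑ ε ∈ S, (Nf ε).integrand z) W :=
          integrable_finsetSum _ fun ε _ => (Nr ε).integrableOn
        exact this }
  have hM₀ : of M₀ - ∑ ε ∈ S, of (Nr ε) ∈ relations :=
    of_sub_sum_of_integrand S M₀ Nr (fun ε _ => rfl) fun z _ => rfl
  -- (4) the final representation on the open unit box `(0,1)^{d+k}`
  set f : (Fin (d + k) → ℝ) → ℝ := fun z => ∑ ε ∈ S, (T : ℝ) ^ d *
      ∏ j, ((MvPolynomial.aeval (fun i => z (Fin.castAdd k i)) (P ε j)) / ((MvPolynomial.aeval (fun i => z (Fin.castAdd k i)) (P ε j)) ^ 2 * (1 - (z (Fin.natAdd d j))) ^ 2 + (z (Fin.natAdd d j)) ^ 2) + 1 / ((1 - (z (Fin.natAdd d j))) ^ 2 + (z (Fin.natAdd d j)) ^ 2)) with hf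
  have hfeq : ∀ z, f z = ∑ ε ∈ S, (Nf ε).integrand z := fun z => by
    simp only [hf, hNfi, r₀]
  have hrat : ∃ p q : MvPolynomial (Fin (d + k)) ℚ,
      (∀ x ∈ {z : Fin (d + k) → ℝ | ∀ i, z i ∈ Set.Ioo (0:ℝ) 1}, MvPolynomial.aeval x q ≠ 0) ∧
      EqOn f (fun x => MvPolynomial.aeval x p / MvPolynomial.aeval x q)
        {z : Fin (d + k) → ℝ | ∀ i, z i ∈ Set.Ioo (0:ℝ) 1} := by
    refine ratOn_sum S fun ε _ => ratOn_mul ?_ (ratOn_prod _ fun j _ => ratOn_kernel (P ε j) j)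
    simpa using ratOn_const (s := {z : Fin (d + k) → ℝ | ∀ i, z i ∈ Set.Ioo (0:ℝ) 1}) ((T : ℚ) ^ d)
  obtain ⟨pM, qM, hqM, hfM⟩ := hrat
  have hUW : volume ({z : Fin (d + k) → ℝ | ∀ i, z i ∈ Set.Ioo (0:ℝ) 1} \ W) = 0 := by
    have hsub : {z : Fin (d + k) → ℝ | ∀ i, z i ∈ Set.Ioo (0:ℝ) 1} \ W ⊆ ⋃ p ∈ F,
        {z : Fin (d + k) → ℝ | MvPolynomial.aeval z (MvPolynomial.rename (Fin.castAdd k) p) = 0} := by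
      intro z hz
      have : ¬ ∀ p : F, MvPolynomial.aeval (fun i => z (Fin.castAdd k i))
          (p : MvPolynomial (Fin d) ℚ) ≠ 0 := fun h => hz.2 ⟨hz.1, h⟩
      simp only [not_forall, not_not] at this
      obtain ⟨p, hp⟩ := this
      simp only [mem_iUnion, mem_setOf_eq]
      exact ⟨p, p.2, by rw [MvPolynomial.aeval_rename]; exact hp⟩
    refine measure_mono_null hsub ((measure_biUnion_null_iff F.countable_toSet).2 fun p hp => ?_)
    refine volume_setOf_aeval_eq_zero _ fun h => hFne ⟨p, hp⟩ ?_
    have hinj : Function.Injective (MvPolynomial.map (algebraMap ℚ ℝ) :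
        MvPolynomial (Fin (d + k)) ℚ → MvPolynomial (Fin (d + k)) ℝ) :=
      MvPolynomial.map_injective _ (algebraMap ℚ ℝ).injective
    have h' : MvPolynomial.rename (Fin.castAdd k) p = (0 : MvPolynomial (Fin (d + k)) ℚ) :=
      hinj (by rw [h, map_zero])
    exact MvPolynomial.rename_injective _ (Fin.castAdd_injective _ _) (by rw [h', map_zero])
  have hWU : W ⊆ {z : Fin (d + k) → ℝ | ∀ i, z i ∈ Set.Ioo (0:ℝ) 1} := fun z hz => hz.1
  let M : IntegralRep (d + k) :=
    { domain := {z | ∀ i, z i ∈ Set.Ioo (0:ℝ) 1}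
      integrand := f
      isSemialgebraic_domain := isSemialgebraic_box (d + k)
      isSemialgebraicFunOn_integrand :=
        (isSemialgebraicFunOn_aeval_div_aeval (isSemialgebraic_box (d + k)) pM qM hqM).congr
          fun z hz => (hfM hz).symm
      integrableOn := by
        have hW0 : IntegrableOn f W := M₀.integrableOn.congr_fun (fun z _ => (hfeq z).symm)
          (IsSemialgebraic.measurableSet_holds hWsa)
        refine hW0.congr_set_ae ?_
        exact ae_eq_set.2 ⟨hUW, by rw [Set.sdiff_eq_empty.2 hWU, measure_empty]⟩ }
  have hMM₀ : of M - of M₀ ∈ relations :=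
    of_sub_of_mem_relations_of_null M M₀ hUW (by
      show volume (W \ {z : Fin (d + k) → ℝ | ∀ i, z i ∈ Set.Ioo (0:ℝ) 1}) = 0
      rw [Set.sdiff_eq_empty.2 hWU, measure_empty]) fun z _ => hfeq z
  -- (5) assemble
  refine ⟨k, d + k, M, rfl, ⟨pM, qM, hqM, hfM⟩, ?_⟩
  have e1 : (fun x => of piRep * x)^[k] (of A) - (fun x => of piRep * x)^[k] (of B) ∈ relations := piPow_congr k hAB
  have e2 : (fun x => of piRep * x)^[k] (of B) - ∑ ε ∈ S, (fun x => of piRep * x)^[k] (of (rc ε)) ∈ relations := by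
    rw [← piPow_sum]; exact piPow_congr k hBsum
  have e3 : ∑ ε ∈ S, (fun x => of piRep * x)^[k] (of (rc ε)) - ∑ ε ∈ S, of (Nf ε) ∈ relations :=
    sum_sub_sum_mem_relations S _ _ fun ε _ => hNf ε
  have e4 : ∑ ε ∈ S, of (Nf ε) - ∑ ε ∈ S, of (Nr ε) ∈ relations :=
    sum_sub_sum_mem_relations S _ _ fun ε _ => hNr ε
  have : (fun x => of piRep * x)^[k] (of A) - of M = ((fun x => of piRep * x)^[k] (of A) - (fun x => of piRep * x)^[k] (of B)) +
      ((fun x => of piRep * x)^[k] (of B) - ∑ ε ∈ S, (fun x => of piRep * x)^[k] (of (rc ε))) +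
      (∑ ε ∈ S, (fun x => of piRep * x)^[k] (of (rc ε)) - ∑ ε ∈ S, of (Nf ε)) +
      (∑ ε ∈ S, of (Nf ε) - ∑ ε ∈ S, of (Nr ε)) - (of M₀ - ∑ ε ∈ S, of (Nr ε)) - (of M - of M₀) := by
    abel
  rw [this]
  exact relations.sub_mem (relations.sub_mem (relations.add_mem (relations.add_mem
    (relations.add_mem e1 e2) e3) e4) hM₀) hMM₀
end Summit.KontsevichZagierPeriods.HurwitzMicroSectors.NormalFormPrinciple.PiBox
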